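import Summits.Ventures.CertifiedManyBodySolver.Observables.EtaPairingExclusionBelowQuarterFilling
import Literature.MathematicalPhysics.QuantumLattice.HubbardFermiSeaTangentRowsCS3AtlasC
import Literature.MathematicalPhysics.QuantumLattice.HubbardFermiSeaTangentRowsLow
import HarnessLib

/-!
# η-PAIRING ODLRO EXCLUSION: the WINDOW FUNCTION `U < W(n)` on the whole hole-doped interval `1/2 < n < 1` from the
# kernel TANGENT Fermi-sea rows (`t' = 0`, `M = 64`) — one theorem per tangent row, the envelope is the reader's `max`

HONEST FRAMING: exclusions in Yang's staggered `s`-wave (η) pair channel, where nobody expects order; NOTHING about `d`-wave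
pairing or the uniform on-site channel; CTL/dictionary class; REGION-valid at zero solves; not a superconductivity verdict; no
phase sentence. Crew hubbard-obs (D-0042), seat hubbard-obs-p1 (`prover-hubbard-obs-p1-g15-0`); part 6 of the g15 η files.
ZERO compute; no definition; no `sorry`; no claim node — every literal is a kernel-checked tangent Fermi-sea row
(`HubbardFermiSeaTangentRows{QuarterFilling,Low,CS3AtlasC}`: `a_k + μ_k·n ≤ e(1,0,U,n)` for every `U ≥ 0`, `0 ≤ n < 2`).

THE WINDOW. Part 1's generic form `etaPairing_exclusion_of_floor` with the affine floor `ℓ = a_k + μ_k n` of the tangent row touching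
at `n_k` gives: for every `U ≥ 0` and `1/2 ≤ n < 1` (indeed any `0 < n < 1`) with
    `U·(2n − 1) < 4(a_k + μ_k n + 1.6211389)`  (margin `m_k(U,n) = (U(1 − 2n) + 4(a_k + μ_k n + 1.6211389))/(2(1 − n)) > 0`),
every translation-invariant ground state of density `n` has NO η-pairing ODLRO and `Re ω(η†_Λ η_Λ) ≤ 64(|Λ'| − |Λ|)²/m_k²`.
The ENVELOPE `W(n) = max_k 4(a_k + μ_k n + 1.6211389)/(2n − 1)` (reader's arithmetic; best row in brackets):
`n = 0.55: U < 9.34 [½]` · `0.60: 3.32 [7/10]` · `0.65: 1.73 [7/10]` · `0.70: 0.927 [7/10]` · `0.725: 0.673 [29/40]` ·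
`0.75: 0.477 [29/40]` · `0.775: 0.342 [31/40]` · `0.80: 0.233 [33/40]` · `0.825: 0.159 [33/40]` · `0.85: 0.0971 [7/8]` ·
`0.875: 0.0575 [7/8]` · `0.90: 0.0263 [37/40]` · `0.925: 0.00766 [37/40]` · `n ≥ 0.95`: no window (the `M = 64` tangent at `n = 1`
lies below `−16/π²`). In particular `(8, n ≤ 0.55, 0)` is covered PREMISE-FREE (the certified (8, ½, 0) cell of g14 needed #463/#472).
The electron-doped mirror `n ↦ 2 − n` of each window is one application of `etaPairing_exclusion_mirror` (part 4).

References: C. N. Yang, PRL 63 (1989) 2144 [Yang1989]; O. Bratteli, D. W. Robinson, OAQSM 2 (1997) Prop. 5.3.19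
[BratteliRobinsonII1997]; E. H. Lieb, M. Loss, Duke Math. J. 71 (1993) 337, §8 [LiebLoss1993]; E. H. Lieb, F. Y. Wu, Physica A 321
(2003) 1, §7 [LiebWuPhysicaA2003].
-/

noncomputable section

namespace Summit.Ventures.CertifiedManyBodySolver.Observables

open Matrix Finset Filter Literature.MathematicalPhysics.QuantumLattice Literature.Probability.LatticeModels
open Literature.MathematicalPhysics.QuantumLattice.HubbardWave0 ThermodynamicLimit
open scoped ComplexOrder Topology

/-- **η-exclusion window from the tangent Fermi-sea row touching at `n₀ = 1/2`** (`ℓ(n) = -0.5879111092 + (-5955 / 4096)·n`,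
`HubbardFermiSeaTangentRowsQuarterFilling`): for `U ≥ 0`, `0 < n < 1` with `U(2n − 1) < 4(-0.5879111092 + (-5955 / 4096)n + 1.6211389)`, every
translation-invariant ground state of density `n` (`t' = 0`) has `M⁻⁴ Re ω(η†η) → 0` and `Re ω(η†_Λ η_Λ) ≤ 64(|Λ'| − |Λ|)²/m²`,
`m = (U(1 − 2n) + 4(-0.5879111092 + (-5955 / 4096)n + 1.6211389))/(2(1 − n))`. [cite: Yang1989, eqs. (6)–(8)] [cite: BratteliRobinsonII1997, Prop. 5.3.19]
[cite: LiebLoss1993, §8, Theorem 8.2] -/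
theorem etaPairing_exclusion_tangentWindow_at_one_div_two {U n : ℝ} (hU : 0 ≤ U) (hn0 : 0 < n) (hn1 : n < 1)
    (hw : U * (2 * n - 1) < 4 * ((-0.5879111092 : ℝ) + (-5955 / 4096) * n + 1.6211389))
    {ω : InfVolFermionState 2} (hω : ω.IsTranslationInvariant) (hρ : ω.density = n)
    (hme : ω.meanEnergy (hubbardTTPrimeFermionInteraction 1 0 U) 1 = energyDensityTT' 1 0 U n) :
    Tendsto (fun M : ℕ =>
        (ω.expect (halfOpenBox 2 M) (etaRaise (fun w : PolySite (halfOpenBox 2 M) => siteStagger (ofLex w.1)) *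
          etaLower (fun w : PolySite (halfOpenBox 2 M) => siteStagger (ofLex w.1)))).re / (M : ℝ) ^ 4)
        atTop (𝓝 0) ∧
      ∀ {Λ Λ' : Finset (Site 2)}, Λ ⊆ Λ' → thicken Λ 1 ⊆ Λ' →
        (ω.expect Λ (etaRaise (fun w : PolySite Λ => siteStagger (ofLex w.1)) *
            etaLower (fun w : PolySite Λ => siteStagger (ofLex w.1)))).re ≤
          64 * ((#Λ' : ℝ) - #Λ) ^ 2 /
            ((U * (1 - 2 * n) + 4 * (((-0.5879111092 : ℝ) + (-5955 / 4096) * n) + 1.6211389)) / (2 * (1 - n))) ^ 2 :=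
  etaPairing_exclusion_of_floor hU hn0 hn1 (fermiSeaTangentRow_tPrime_zero_at_one_div_two hU hn0.le (by linarith))
    (by linarith) hω hρ hme

/-- **η-exclusion window from the tangent Fermi-sea row touching at `n₀ = 7/10`** (`ℓ(n) = -1.0141570637 + (-3009 / 4096)·n`,
`HubbardFermiSeaTangentRowsLow`): for `U ≥ 0`, `0 < n < 1` with `U(2n − 1) < 4(-1.0141570637 + (-3009 / 4096)n + 1.6211389)`, every
translation-invariant ground state of density `n` (`t' = 0`) has `M⁻⁴ Re ω(η†η) → 0` and `Re ω(η†_Λ η_Λ) ≤ 64(|Λ'| − |Λ|)²/m²`,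
`m = (U(1 − 2n) + 4(-1.0141570637 + (-3009 / 4096)n + 1.6211389))/(2(1 − n))`. [cite: Yang1989, eqs. (6)–(8)] [cite: BratteliRobinsonII1997, Prop. 5.3.19]
[cite: LiebLoss1993, §8, Theorem 8.2] -/
theorem etaPairing_exclusion_tangentWindow_at_seven_div_ten {U n : ℝ} (hU : 0 ≤ U) (hn0 : 0 < n) (hn1 : n < 1)
    (hw : U * (2 * n - 1) < 4 * ((-1.0141570637 : ℝ) + (-3009 / 4096) * n + 1.6211389))
    {ω : InfVolFermionState 2} (hω : ω.IsTranslationInvariant) (hρ : ω.density = n)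
    (hme : ω.meanEnergy (hubbardTTPrimeFermionInteraction 1 0 U) 1 = energyDensityTT' 1 0 U n) :
    Tendsto (fun M : ℕ =>
        (ω.expect (halfOpenBox 2 M) (etaRaise (fun w : PolySite (halfOpenBox 2 M) => siteStagger (ofLex w.1)) *
          etaLower (fun w : PolySite (halfOpenBox 2 M) => siteStagger (ofLex w.1)))).re / (M : ℝ) ^ 4)
        atTop (𝓝 0) ∧
      ∀ {Λ Λ' : Finset (Site 2)}, Λ ⊆ Λ' → thicken Λ 1 ⊆ Λ' →
        (ω.expect Λ (etaRaise (fun w : PolySite Λ => siteStagger (ofLex w.1)) *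
            etaLower (fun w : PolySite Λ => siteStagger (ofLex w.1)))).re ≤
          64 * ((#Λ' : ℝ) - #Λ) ^ 2 /
            ((U * (1 - 2 * n) + 4 * (((-1.0141570637 : ℝ) + (-3009 / 4096) * n) + 1.6211389)) / (2 * (1 - n))) ^ 2 :=
  etaPairing_exclusion_of_floor hU hn0 hn1 (fermiSeaTangentRow_tPrime_zero_at_seven_div_ten hU hn0.le (by linarith))
    (by linarith) hω hρ hme

/-- **η-exclusion window from the tangent Fermi-sea row touching at `n₀ = 29/40`** (`ℓ(n) = -1.0777826529 + (-1321 / 2048)·n`,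
`HubbardFermiSeaTangentRowsCS3AtlasC`): for `U ≥ 0`, `0 < n < 1` with `U(2n − 1) < 4(-1.0777826529 + (-1321 / 2048)n + 1.6211389)`, every
translation-invariant ground state of density `n` (`t' = 0`) has `M⁻⁴ Re ω(η†η) → 0` and `Re ω(η†_Λ η_Λ) ≤ 64(|Λ'| − |Λ|)²/m²`,
`m = (U(1 − 2n) + 4(-1.0777826529 + (-1321 / 2048)n + 1.6211389))/(2(1 − n))`. [cite: Yang1989, eqs. (6)–(8)] [cite: BratteliRobinsonII1997, Prop. 5.3.19]
[cite: LiebLoss1993, §8, Theorem 8.2] -/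
theorem etaPairing_exclusion_tangentWindow_at_twentynine_div_forty {U n : ℝ} (hU : 0 ≤ U) (hn0 : 0 < n) (hn1 : n < 1)
    (hw : U * (2 * n - 1) < 4 * ((-1.0777826529 : ℝ) + (-1321 / 2048) * n + 1.6211389))
    {ω : InfVolFermionState 2} (hω : ω.IsTranslationInvariant) (hρ : ω.density = n)
    (hme : ω.meanEnergy (hubbardTTPrimeFermionInteraction 1 0 U) 1 = energyDensityTT' 1 0 U n) :
    Tendsto (fun M : ℕ =>
        (ω.expect (halfOpenBox 2 M) (etaRaise (fun w : PolySite (halfOpenBox 2 M) => siteStagger (ofLex w.1)) *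
          etaLower (fun w : PolySite (halfOpenBox 2 M) => siteStagger (ofLex w.1)))).re / (M : ℝ) ^ 4)
        atTop (𝓝 0) ∧
      ∀ {Λ Λ' : Finset (Site 2)}, Λ ⊆ Λ' → thicken Λ 1 ⊆ Λ' →
        (ω.expect Λ (etaRaise (fun w : PolySite Λ => siteStagger (ofLex w.1)) *
            etaLower (fun w : PolySite Λ => siteStagger (ofLex w.1)))).re ≤
          64 * ((#Λ' : ℝ) - #Λ) ^ 2 /
            ((U * (1 - 2 * n) + 4 * (((-1.0777826529 : ℝ) + (-1321 / 2048) * n) + 1.6211389)) / (2 * (1 - n))) ^ 2 :=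
  etaPairing_exclusion_of_floor hU hn0 hn1 (fermiSeaTangentRow_tPrime_zero_at_twentynine_div_forty hU hn0.le (by linarith))
    (by linarith) hω hρ hme

/-- **η-exclusion window from the tangent Fermi-sea row touching at `n₀ = 31/40`** (`ℓ(n) = -1.1975537925 + (-995 / 2048)·n`,
`HubbardFermiSeaTangentRowsCS3AtlasC`): for `U ≥ 0`, `0 < n < 1` with `U(2n − 1) < 4(-1.1975537925 + (-995 / 2048)n + 1.6211389)`, every
translation-invariant ground state of density `n` (`t' = 0`) has `M⁻⁴ Re ω(η†η) → 0` and `Re ω(η†_Λ η_Λ) ≤ 64(|Λ'| − |Λ|)²/m²`,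
`m = (U(1 − 2n) + 4(-1.1975537925 + (-995 / 2048)n + 1.6211389))/(2(1 − n))`. [cite: Yang1989, eqs. (6)–(8)] [cite: BratteliRobinsonII1997, Prop. 5.3.19]
[cite: LiebLoss1993, §8, Theorem 8.2] -/
theorem etaPairing_exclusion_tangentWindow_at_thirtyone_div_forty {U n : ℝ} (hU : 0 ≤ U) (hn0 : 0 < n) (hn1 : n < 1)
    (hw : U * (2 * n - 1) < 4 * ((-1.1975537925 : ℝ) + (-995 / 2048) * n + 1.6211389))
    {ω : InfVolFermionState 2} (hω : ω.IsTranslationInvariant) (hρ : ω.density = n)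
    (hme : ω.meanEnergy (hubbardTTPrimeFermionInteraction 1 0 U) 1 = energyDensityTT' 1 0 U n) :
    Tendsto (fun M : ℕ =>
        (ω.expect (halfOpenBox 2 M) (etaRaise (fun w : PolySite (halfOpenBox 2 M) => siteStagger (ofLex w.1)) *
          etaLower (fun w : PolySite (halfOpenBox 2 M) => siteStagger (ofLex w.1)))).re / (M : ℝ) ^ 4)
        atTop (𝓝 0) ∧
      ∀ {Λ Λ' : Finset (Site 2)}, Λ ⊆ Λ' → thicken Λ 1 ⊆ Λ' →
        (ω.expect Λ (etaRaise (fun w : PolySite Λ => siteStagger (ofLex w.1)) *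
            etaLower (fun w : PolySite Λ => siteStagger (ofLex w.1)))).re ≤
          64 * ((#Λ' : ℝ) - #Λ) ^ 2 /
            ((U * (1 - 2 * n) + 4 * (((-1.1975537925 : ℝ) + (-995 / 2048) * n) + 1.6211389)) / (2 * (1 - n))) ^ 2 :=
  etaPairing_exclusion_of_floor hU hn0 hn1 (fermiSeaTangentRow_tPrime_zero_at_thirtyone_div_forty hU hn0.le (by linarith))
    (by linarith) hω hρ hme

/-- **η-exclusion window from the tangent Fermi-sea row touching at `n₀ = 33/40`** (`ℓ(n) = -1.2936211915 + (-749 / 2048)·n`,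
`HubbardFermiSeaTangentRowsCS3AtlasC`): for `U ≥ 0`, `0 < n < 1` with `U(2n − 1) < 4(-1.2936211915 + (-749 / 2048)n + 1.6211389)`, every
translation-invariant ground state of density `n` (`t' = 0`) has `M⁻⁴ Re ω(η†η) → 0` and `Re ω(η†_Λ η_Λ) ≤ 64(|Λ'| − |Λ|)²/m²`,
`m = (U(1 − 2n) + 4(-1.2936211915 + (-749 / 2048)n + 1.6211389))/(2(1 − n))`. [cite: Yang1989, eqs. (6)–(8)] [cite: BratteliRobinsonII1997, Prop. 5.3.19]
[cite: LiebLoss1993, §8, Theorem 8.2] -/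
theorem etaPairing_exclusion_tangentWindow_at_thirtythree_div_forty {U n : ℝ} (hU : 0 ≤ U) (hn0 : 0 < n) (hn1 : n < 1)
    (hw : U * (2 * n - 1) < 4 * ((-1.2936211915 : ℝ) + (-749 / 2048) * n + 1.6211389))
    {ω : InfVolFermionState 2} (hω : ω.IsTranslationInvariant) (hρ : ω.density = n)
    (hme : ω.meanEnergy (hubbardTTPrimeFermionInteraction 1 0 U) 1 = energyDensityTT' 1 0 U n) :
    Tendsto (fun M : ℕ =>
        (ω.expect (halfOpenBox 2 M) (etaRaise (fun w : PolySite (halfOpenBox 2 M) => siteStagger (ofLex w.1)) *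
          etaLower (fun w : PolySite (halfOpenBox 2 M) => siteStagger (ofLex w.1)))).re / (M : ℝ) ^ 4)
        atTop (𝓝 0) ∧
      ∀ {Λ Λ' : Finset (Site 2)}, Λ ⊆ Λ' → thicken Λ 1 ⊆ Λ' →
        (ω.expect Λ (etaRaise (fun w : PolySite Λ => siteStagger (ofLex w.1)) *
            etaLower (fun w : PolySite Λ => siteStagger (ofLex w.1)))).re ≤
          64 * ((#Λ' : ℝ) - #Λ) ^ 2 /
            ((U * (1 - 2 * n) + 4 * (((-1.2936211915 : ℝ) + (-749 / 2048) * n) + 1.6211389)) / (2 * (1 - n))) ^ 2 :=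
  etaPairing_exclusion_of_floor hU hn0 hn1 (fermiSeaTangentRow_tPrime_zero_at_thirtythree_div_forty hU hn0.le (by linarith))
    (by linarith) hω hρ hme

/-- **η-exclusion window from the tangent Fermi-sea row touching at `n₀ = 7/8`** (`ℓ(n) = -1.3928903590 + (-509 / 2048)·n`,
`HubbardFermiSeaTangentRowsCS3AtlasC`): for `U ≥ 0`, `0 < n < 1` with `U(2n − 1) < 4(-1.3928903590 + (-509 / 2048)n + 1.6211389)`, every
translation-invariant ground state of density `n` (`t' = 0`) has `M⁻⁴ Re ω(η†η) → 0` and `Re ω(η†_Λ η_Λ) ≤ 64(|Λ'| − |Λ|)²/m²`,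
`m = (U(1 − 2n) + 4(-1.3928903590 + (-509 / 2048)n + 1.6211389))/(2(1 − n))`. [cite: Yang1989, eqs. (6)–(8)] [cite: BratteliRobinsonII1997, Prop. 5.3.19]
[cite: LiebLoss1993, §8, Theorem 8.2] -/
theorem etaPairing_exclusion_tangentWindow_at_seven_div_eight {U n : ℝ} (hU : 0 ≤ U) (hn0 : 0 < n) (hn1 : n < 1)
    (hw : U * (2 * n - 1) < 4 * ((-1.3928903590 : ℝ) + (-509 / 2048) * n + 1.6211389))
    {ω : InfVolFermionState 2} (hω : ω.IsTranslationInvariant) (hρ : ω.density = n)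
    (hme : ω.meanEnergy (hubbardTTPrimeFermionInteraction 1 0 U) 1 = energyDensityTT' 1 0 U n) :
    Tendsto (fun M : ℕ =>
        (ω.expect (halfOpenBox 2 M) (etaRaise (fun w : PolySite (halfOpenBox 2 M) => siteStagger (ofLex w.1)) *
          etaLower (fun w : PolySite (halfOpenBox 2 M) => siteStagger (ofLex w.1)))).re / (M : ℝ) ^ 4)
        atTop (𝓝 0) ∧
      ∀ {Λ Λ' : Finset (Site 2)}, Λ ⊆ Λ' → thicken Λ 1 ⊆ Λ' →
        (ω.expect Λ (etaRaise (fun w : PolySite Λ => siteStagger (ofLex w.1)) *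
            etaLower (fun w : PolySite Λ => siteStagger (ofLex w.1)))).re ≤
          64 * ((#Λ' : ℝ) - #Λ) ^ 2 /
            ((U * (1 - 2 * n) + 4 * (((-1.3928903590 : ℝ) + (-509 / 2048) * n) + 1.6211389)) / (2 * (1 - n))) ^ 2 :=
  etaPairing_exclusion_of_floor hU hn0 hn1 (fermiSeaTangentRow_tPrime_zero_at_seven_div_eight hU hn0.le (by linarith))
    (by linarith) hω hρ hme

/-- **η-exclusion window from the tangent Fermi-sea row touching at `n₀ = 37/40`** (`ℓ(n) = -1.4853685862 + (-297 / 2048)·n`,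
`HubbardFermiSeaTangentRowsCS3AtlasC`): for `U ≥ 0`, `0 < n < 1` with `U(2n − 1) < 4(-1.4853685862 + (-297 / 2048)n + 1.6211389)`, every
translation-invariant ground state of density `n` (`t' = 0`) has `M⁻⁴ Re ω(η†η) → 0` and `Re ω(η†_Λ η_Λ) ≤ 64(|Λ'| − |Λ|)²/m²`,
`m = (U(1 − 2n) + 4(-1.4853685862 + (-297 / 2048)n + 1.6211389))/(2(1 − n))`. [cite: Yang1989, eqs. (6)–(8)] [cite: BratteliRobinsonII1997, Prop. 5.3.19]
[cite: LiebLoss1993, §8, Theorem 8.2] -/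
theorem etaPairing_exclusion_tangentWindow_at_thirtyseven_div_forty {U n : ℝ} (hU : 0 ≤ U) (hn0 : 0 < n) (hn1 : n < 1)
    (hw : U * (2 * n - 1) < 4 * ((-1.4853685862 : ℝ) + (-297 / 2048) * n + 1.6211389))
    {ω : InfVolFermionState 2} (hω : ω.IsTranslationInvariant) (hρ : ω.density = n)
    (hme : ω.meanEnergy (hubbardTTPrimeFermionInteraction 1 0 U) 1 = energyDensityTT' 1 0 U n) :
    Tendsto (fun M : ℕ =>
        (ω.expect (halfOpenBox 2 M) (etaRaise (fun w : PolySite (halfOpenBox 2 M) => siteStagger (ofLex w.1)) *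
          etaLower (fun w : PolySite (halfOpenBox 2 M) => siteStagger (ofLex w.1)))).re / (M : ℝ) ^ 4)
        atTop (𝓝 0) ∧
      ∀ {Λ Λ' : Finset (Site 2)}, Λ ⊆ Λ' → thicken Λ 1 ⊆ Λ' →
        (ω.expect Λ (etaRaise (fun w : PolySite Λ => siteStagger (ofLex w.1)) *
            etaLower (fun w : PolySite Λ => siteStagger (ofLex w.1)))).re ≤
          64 * ((#Λ' : ℝ) - #Λ) ^ 2 /
            ((U * (1 - 2 * n) + 4 * (((-1.4853685862 : ℝ) + (-297 / 2048) * n) + 1.6211389)) / (2 * (1 - n))) ^ 2 :=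
  etaPairing_exclusion_of_floor hU hn0 hn1 (fermiSeaTangentRow_tPrime_zero_at_thirtyseven_div_forty hU hn0.le (by linarith))
    (by linarith) hω hρ hme

end Summit.Ventures.CertifiedManyBodySolver.Observables

end
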